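import Summits.QuantumFields.BalabanUV.Beta.RemainderExplicitHistoryDiagonalOneStepMonotone

/-!
# RemainderExplicitHistoryDiagonalEchoMonotone — ROAD P3, ORDER-0 PROFILE FAMILY: EXACT MONOTONICITY OF THE MATCHED DISCREPANCY IN THE
# POSITION BEYOND THE MEMORY, FOR EVERY NON-INCREASING PROFILE — for two infrared-pinned runs (A: `K` steps, B: `K + n` steps) of
# `β_{k+1} = b + Σ_{a≤k} ρ(a)·min(g_k, |g_k − g_{k−a}|)` with `ρ(1) ≥ ρ(2) ≥ ⋯ ≥ 0`, `Σρ ≤ W`, `Wγ ≤ 2b`, the matched discrepancy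
# `d_j = 1∕(g^B_{j+n})² − 1∕(g^A_j)²` is NON-INCREASING at every position `j` beyond the memory (`ρ(a) = 0` for `a > j`): census item (i′) of
# generations 50–53 SETTLED IN THE SOURCE-FREE STRETCH for every memory length, every shape, every shift, by an ECHO COUNT —
# `d_j ≤ (K − j)·Σ_{i<j} ρ(j−i)e_i` (window identity + monotone profile) against the ultraviolet suppression `(g^A_j)³(K − j) ≤ γ∕b` — with the
# quantitative decrement `d_j − d_{j+1} ≥ (1 − Wγ∕(2b))·Σ_{i<j} ρ(j−i)e_i`; family read-out: beyond the memory the continuum correction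
# `astar g m − invSq g m (K−m)` grows towards the ultraviolet end of every run (station S-d4p3-g54-1 «the echo count», first file)

Cell `pub-balaban`, β-function sub-cell, BINDER row D4 «RemainderConst leaves for Bałaban's split» (`HOME/BINDER-OWNERS.md`; owner lineage
`b2b-balaban-beta-an4`; this file by co-owner #3 lineage `b2b-balaban-beta-d4-p3`, road P3 «the reduction road», generation 54, station
S-d4p3-g54-1, first file; imports generation 53's `RemainderExplicitHistoryDiagonalOneStepMonotone` (hence generation 49's `…Window`,
`…TwoRun`, `…Weights`, `…Monotone`)), β-FLOW TEAM duty (1); FREEZE (0) honoured (def-free module in road P3's own `RemainderExplicit*`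
series; no leaf, no interface, no Literature file).  SOURCE OF THE SHAPES ONLY: [Balaban1987RG1] (0.20) p. 256, (0.31) and Thm 2 p. 259,
§5 p. 298.  [folklore] real analysis about ONE explicit toy family (ours), road P3's ORDER-0 PROFILE FAMILY (generation 44).
HONEST FRAMING: *"Discharging BetaPertH makes Bałaban's UV stability UNCONDITIONAL — a real constructive-QFT result; it is NOT the continuum
limit and NOT the Clay problem."*  THIS FILE DISCHARGES NOTHING OF THE KIND; nothing of Bałaban's (1.22) is asserted or constructed; row D4
class UNCHANGED (critical-path width 0; instance 0∕1; D4 DISCHARGE NO DATE); NOT B12 Thm 2, NOT BetaPertH, NOT continuum, NOT Clay.  HONEST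
DEPENDENCY: continuum YM on T⁴ ⇐ BetaPertH ∧ nine spine estimates (0/9 proved); BetaPertH ⇐ (D1) ∧ (D4) ∧ CAP+tail; G-an2-4 gates asym, D1
and NE2/3/4.  ABSOLUTE RULE: nothing is cited as a fact.  All letters NOT-IN-PRINT; `BetaFlowAsPrinted S` records a Markov β_n only.

THE QUESTION (census OPEN (i′) of generations 50–53).  With `e_i = g^A_i − g^B_{i+n} ≥ 0` and `d_j ≥ 0` (generation 47's maximum principle),
generation 49's step identity reads `d_j − d_{j+1} = E_j + Σ_{i≤j} ρ(j−i)(e_i − e_j)`; generation 53 settled one-step memory by a backward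
induction and located, for memory `A ≥ 2`, the source-free stretch `j ≥ A` as the hard half («the pin selects the decaying Perron mode; a proof
needs a cone preserved by the backward transfer»).  THIS FILE settles that half for EVERY non-increasing profile WITHOUT a cone and without any
induction.  At a position `j₀` beyond the memory: (1) `d_{j₀} − d_{j₀+1} = S − R′e_{j₀}` with `S = Σ_{i<j₀} ρ(j₀−i)e_i`, `R′ = Σ_{i<j₀} ρ(j₀−i) ≤ W`
(`disc_step_beyond`); (2) by the WINDOW IDENTITY of generation 49, `d_{j₀} = Σ_{i<j₀} e_i·(R(K−i) − R(j₀−i)) + [window terms ≤ 0]`, and the ECHO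
WEIGHT `R(K−i) − R(j₀−i) = Σ_{a∈[j₀−i,K−i)} ρ(a)` of the past gap `e_i` counts the `K − j₀` positions still ahead, each with a weight
`ρ(a) ≤ ρ(j₀−i)` (NON-INCREASING profile) — so `d_{j₀} ≤ (K − j₀)·S` (`disc_le_mul_windowSum`); (3) `e_{j₀} ≤ ((g^A_{j₀})³∕2)·d_{j₀}` (generation 49's
`gap_le_cube_mul`) and the ULTRAVIOLET SUPPRESSION `(g^A_{j₀})³·(K − j₀) ≤ γ∕b` (`b(K − j₀) ≤ 1∕(g^A_{j₀})²`, `g ≤ γ`; `cube_mul_dist_le`); hence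
`R′e_{j₀} ≤ (Wγ∕(2b))·S` and `d_{j₀} − d_{j₀+1} ≥ (1 − Wγ∕(2b))·S ≥ 0`.  The pin enters only through the window identity; the count `K − j₀` of the
echoes ahead is exactly compensated by the distance `K − j₀` in the ultraviolet suppression.  The memory zone `j < A` (where B's extra-age
source `E_j > 0` and the future sources enter `d_j`) is NOT treated here (seat numerics: the forward-induction criterion `κ_j d_j ≤ E_j` holds
with ratio ≤ 0.15 in ≈ 1 000 cases; `HOME/b2b-balaban-beta-d4-p3/g54/numerics/`).

WHAT IS PROVED ([folklore]; 0 sorry; 0 `def`).  §1 `profile_le_of_le`, `sum_Ico_le_mul` (`Σ_{a∈[m,k)} ρ(a) ≤ (k−m)ρ(m)`), `echo_weight_le`,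
`partialSum_le_of_support`.  §2 `disc_le_echo` (`d_{j₀} ≤ Σ_{i<j₀} e_i(R(K−i) − R(j₀−i))` beyond the memory, any `ρ ≥ 0`), `disc_le_mul_windowSum`
(`d_{j₀} ≤ (K − j₀)·S`, non-increasing `ρ`).  §3 `cube_mul_dist_le` (`(g_j)³(K − j) ≤ γ∕b` on a box run).  §4 `disc_step_beyond`,
**`windowSum_le_disc_step`** (`(1 − Wγ∕(2b))·S ≤ d_{j₀} − d_{j₀+1}`), **`disc_succ_le_disc_beyond`** (`d_{j₀+1} ≤ d_{j₀}` under `Wγ ≤ 2b`),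
`disc_succ_le_disc_of_memory_le` (memory `A`: every `A ≤ j < K`).  §5 PINNED FAMILY: **`invSq_shift_mono_beyond`**,
**`astar_sub_invSq_mono_beyond`** (`astar g m − invSq g m (j+1) ≤ astar g (m+1) − invSq g (m+1) j` for `j ≥ A`), `astar_sub_invSq_mono_beyond_le`.
-/

noncomputable section

open Finset Filter Topology

namespace Summit.QuantumFields.BalabanUV.Beta.RemainderExplicitHistoryDiagonalEchoMonotone

open Literature.MathematicalPhysics.QuantumFieldTheory.Balaban1983to89
open Literature.MathematicalPhysics.QuantumFieldTheory.Balaban1983to89.FlowStep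
open Literature.MathematicalPhysics.QuantumFieldTheory.Balaban1983to89.T4CouplingMatching
open Literature.MathematicalPhysics.QuantumFieldTheory.Balaban1983to89.T4ContinuumCoupling
open Summit.QuantumFields.BalabanUV.Beta.RemainderExplicitHistoryDiagonalMonotone
open Summit.QuantumFields.BalabanUV.Beta.RemainderExplicitHistoryDiagonalWeights
open Summit.QuantumFields.BalabanUV.Beta.RemainderExplicitHistoryDiagonalTwoRun
open Summit.QuantumFields.BalabanUV.Beta.RemainderExplicitHistoryDiagonalWindow
open Summit.QuantumFields.BalabanUV.Beta.RemainderExplicitHistoryDiagonalOneStepMonotone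

variable {β : HBeta} {b γ W : ℝ} {ρ : ℕ → ℝ}

/-! ## §1 The echo count of a non-increasing profile -/

/-- A profile that is non-increasing on the positive ages is dominated there by its earlier values: `1 ≤ m ≤ a ⇒ ρ(a) ≤ ρ(m)`. [folklore] -/
theorem profile_le_of_le (hmono : ∀ a, 1 ≤ a → ρ (a + 1) ≤ ρ a) {m a : ℕ} (hm : 1 ≤ m) (hma : m ≤ a) : ρ a ≤ ρ m := by
  induction a, hma using Nat.le_induction with
  | base => exact le_rfl
  | succ a hma ih => exact (hmono a (le_trans hm hma)).trans ih

/-- **THE ECHO COUNT.**  For a profile non-increasing on the positive ages and `1 ≤ m`: `Σ_{a∈[m,k)} ρ(a) ≤ (k − m)·ρ(m)` — the ages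
`m, m+1, …, k−1` through which a past coupling gap still feeds the `k − m` remaining positions carry at most `k − m` copies of the weight of
the youngest of them. [folklore] -/
theorem sum_Ico_le_mul (hmono : ∀ a, 1 ≤ a → ρ (a + 1) ≤ ρ a) {m : ℕ} (hm : 1 ≤ m) (k : ℕ) :
    ∑ a ∈ Ico m k, ρ a ≤ ((k - m : ℕ) : ℝ) * ρ m := by
  calc ∑ a ∈ Ico m k, ρ a ≤ ∑ _a ∈ Ico m k, ρ m :=
        Finset.sum_le_sum fun a ha => profile_le_of_le hmono hm (Finset.mem_Ico.mp ha).1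
    _ = ((k - m : ℕ) : ℝ) * ρ m := by rw [Finset.sum_const, Nat.card_Ico, nsmul_eq_mul]

/-- THE ECHO WEIGHT OF A PAST POSITION: for `i < j₀ ≤ K`, `R(K−i) − R(j₀−i) = Σ_{a∈[j₀−i,K−i)} ρ(a) ≤ (K − j₀)·ρ(j₀ − i)`
(`R(k) = Σ_{a<k} ρ(a)`). [folklore] -/
theorem echo_weight_le (hmono : ∀ a, 1 ≤ a → ρ (a + 1) ≤ ρ a) {i j₀ K : ℕ} (hi : i < j₀) (hj₀ : j₀ ≤ K) :
    ∑ a ∈ range (K - i), ρ a - ∑ a ∈ range (j₀ - i), ρ a ≤ ((K - j₀ : ℕ) : ℝ) * ρ (j₀ - i) := by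
  rw [← Finset.sum_Ico_eq_sub _ (show j₀ - i ≤ K - i by omega)]
  have h := sum_Ico_le_mul hmono (show 1 ≤ j₀ - i by omega) (K - i)
  rwa [show K - i - (j₀ - i) = K - j₀ by omega] at h

/-- BEYOND THE MEMORY THE PARTIAL SUMS SATURATE: if `ρ(a) = 0` for every `a > j₀` (`ρ ≥ 0`), then `Σ_{a<q} ρ(a) ≤ Σ_{a<p} ρ(a)` whenever
`j₀ < p`. [folklore] -/
theorem partialSum_le_of_support (hρ0 : ∀ a, 0 ≤ ρ a) {j₀ p : ℕ} (hsupp : ∀ a, j₀ < a → ρ a = 0) (hp : j₀ < p) (q : ℕ) :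
    ∑ a ∈ range q, ρ a ≤ ∑ a ∈ range p, ρ a := by
  rcases le_or_gt q p with hqp | hpq
  · exact partialSum_mono hρ0 hqp
  · rw [← Finset.sum_range_add_sum_Ico _ hpq.le]
    have h0 : ∑ a ∈ Ico p q, ρ a = 0 :=
      Finset.sum_eq_zero fun a ha => hsupp a (lt_of_lt_of_le hp (Finset.mem_Ico.mp ha).1)
    rw [h0, add_zero]

/-! ## §2 Beyond the memory the matched discrepancy is at most the echo mass of the past coupling gaps -/

/-- **THE DISCREPANCY BEYOND THE MEMORY IS AT MOST THE ECHO MASS OF THE PAST GAPS.**  Two runs of road P3's order-0 profile family (`b > 0`,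
`ρ ≥ 0`; A: `K` steps, B: `K + n` steps, positive couplings) pinned `g^A_K = g^B_{K+n}`, and a position `j₀ ≤ K` BEYOND THE MEMORY (`ρ(a) = 0`
for all `a > j₀`).  THEN `1∕(g^B_{j₀+n})² − 1∕(g^A_{j₀})² ≤ Σ_{i<j₀} (g^A_i − g^B_{i+n})·(R(K−i) − R(j₀−i))`: in generation 49's
`window_identity` B's extra-age source vanishes on `[j₀, K)` (its ages exceed `j₀`), and every window position `i ≥ j₀` exerts on the
window at most its saturated self-weight (`partialSum_le_of_support`) on a nonnegative gap (the maximum principle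
`…TwoRun.invSq_le_invSq_shift_run`). [cite: Balaban1987RG1, (0.20) p.256 and Thm 2 p.259] -/
theorem disc_le_echo
    (hβ : ∀ (k : ℕ) (p : Fin (k + 1) → ℝ),
      β k p = b + ∑ i : Fin (k + 1), ρ (k - i) * min (p (Fin.last k)) (|p (Fin.last k) - p i|))
    (hb : 0 < b) (hρ0 : ∀ a, 0 ≤ ρ a) {K n : ℕ} {gA gB : ℕ → ℝ} (hA : RGEqH K β gA) (hB : RGEqH (K + n) β gB)
    (hApos : ∀ k, k ≤ K → 0 < gA k) (hBpos : ∀ k, k ≤ K + n → 0 < gB k) (hpin : gA K = gB (K + n)) {j₀ : ℕ} (hj₀ : j₀ ≤ K)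
    (hsupp : ∀ a, j₀ < a → ρ a = 0) :
    1 / (gB (j₀ + n)) ^ 2 - 1 / (gA j₀) ^ 2
      ≤ ∑ i ∈ range j₀, (gA i - gB (i + n)) * (∑ a ∈ range (K - i), ρ a - ∑ a ∈ range (j₀ - i), ρ a) := by
  rw [window_identity hβ hb hρ0 hA hB hApos hBpos hpin hj₀]
  have hdom := invSq_le_invSq_shift_run hβ hb hρ0 hA hB hApos hBpos hpin
  have hE : ∑ j ∈ Ico j₀ K, ∑ i ∈ range n, ρ (j + n - i) * (gB (j + n) - gB i) = 0 := by
    refine Finset.sum_eq_zero fun j hj => Finset.sum_eq_zero fun i hi => ?_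
    have hj' := (Finset.mem_Ico.mp hj).1
    have hi' := Finset.mem_range.mp hi
    rw [hsupp (j + n - i) (by omega), zero_mul]
  have hneg : ∑ i ∈ Ico j₀ K, (gA i - gB (i + n)) * (∑ a ∈ range (K - i), ρ a - ∑ a ∈ range (i + 1), ρ a) ≤ 0 := by
    refine Finset.sum_nonpos fun i hi => ?_
    have hi' := Finset.mem_Ico.mp hi
    have he : 0 ≤ gA i - gB (i + n) := by
      linarith [le_of_one_div_sq_le (hApos i hi'.2.le) (hBpos (i + n) (by omega)) (hdom i hi'.2.le)]
    have hR : ∑ a ∈ range (K - i), ρ a ≤ ∑ a ∈ range (i + 1), ρ a :=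
      partialSum_le_of_support hρ0 hsupp (by omega) (K - i)
    exact mul_nonpos_of_nonneg_of_nonpos he (by linarith)
  linarith

/-- … AND HENCE AT MOST `K − j₀` ECHOES OF THE CURRENT WINDOW SUM when the profile is non-increasing on the positive ages:
`1∕(g^B_{j₀+n})² − 1∕(g^A_{j₀})² ≤ (K − j₀)·Σ_{i<j₀} ρ(j₀−i)·(g^A_i − g^B_{i+n})` (`echo_weight_le` on nonnegative gaps). [cite: Balaban1987RG1, (0.20) p.256 and Thm 2 p.259] -/
theorem disc_le_mul_windowSum
    (hβ : ∀ (k : ℕ) (p : Fin (k + 1) → ℝ),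
      β k p = b + ∑ i : Fin (k + 1), ρ (k - i) * min (p (Fin.last k)) (|p (Fin.last k) - p i|))
    (hb : 0 < b) (hρ0 : ∀ a, 0 ≤ ρ a) (hmono : ∀ a, 1 ≤ a → ρ (a + 1) ≤ ρ a) {K n : ℕ} {gA gB : ℕ → ℝ} (hA : RGEqH K β gA)
    (hB : RGEqH (K + n) β gB) (hApos : ∀ k, k ≤ K → 0 < gA k) (hBpos : ∀ k, k ≤ K + n → 0 < gB k) (hpin : gA K = gB (K + n))
    {j₀ : ℕ} (hj₀ : j₀ ≤ K) (hsupp : ∀ a, j₀ < a → ρ a = 0) :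
    1 / (gB (j₀ + n)) ^ 2 - 1 / (gA j₀) ^ 2
      ≤ ((K - j₀ : ℕ) : ℝ) * ∑ i ∈ range j₀, ρ (j₀ - i) * (gA i - gB (i + n)) := by
  have hdom := invSq_le_invSq_shift_run hβ hb hρ0 hA hB hApos hBpos hpin
  refine (disc_le_echo hβ hb hρ0 hA hB hApos hBpos hpin hj₀ hsupp).trans ?_
  rw [Finset.mul_sum]
  refine Finset.sum_le_sum fun i hi => ?_
  have hi' := Finset.mem_range.mp hi
  have he : 0 ≤ gA i - gB (i + n) := by
    linarith [le_of_one_div_sq_le (hApos i (by omega)) (hBpos (i + n) (by omega)) (hdom i (by omega))]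
  have hw := echo_weight_le hmono hi' hj₀ (K := K)
  calc (gA i - gB (i + n)) * (∑ a ∈ range (K - i), ρ a - ∑ a ∈ range (j₀ - i), ρ a)
      ≤ (gA i - gB (i + n)) * (((K - j₀ : ℕ) : ℝ) * ρ (j₀ - i)) := mul_le_mul_of_nonneg_left hw he
    _ = ((K - j₀ : ℕ) : ℝ) * (ρ (j₀ - i) * (gA i - gB (i + n))) := by ring

/-! ## §3 Ultraviolet suppression: the cube of a coupling times its distance to the pin is at most `γ∕b` -/

/-- **ULTRAVIOLET SUPPRESSION.**  On a run of the family in ]0,γ] (`b > 0`, `γ > 0`, `ρ ≥ 0`; `K` steps): for every `j ≤ K`,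
`(g_j)³·(K − j) ≤ γ∕b` — the floor `b ≤ β` gives `b·(K − j) ≤ 1∕g_j²` (`T4CouplingMatching.inv_sq_lower_of_betaLower` BY NAME) and `g_j ≤ γ`.
[cite: Balaban1987RG1, (0.31) p.259] -/
theorem cube_mul_dist_le
    (hβ : ∀ (k : ℕ) (p : Fin (k + 1) → ℝ),
      β k p = b + ∑ i : Fin (k + 1), ρ (k - i) * min (p (Fin.last k)) (|p (Fin.last k) - p i|))
    (hb : 0 < b) (hρ0 : ∀ a, 0 ≤ ρ a) {K : ℕ} {g : ℕ → ℝ} (hA : RGEqH K β g)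
    (hbox : ∀ k, k ≤ K → 0 < g k ∧ g k ≤ γ) {j : ℕ} (hj : j ≤ K) :
    (g j) ^ 3 * ((K - j : ℕ) : ℝ) ≤ γ / b := by
  have hlo : BetaLowerH b γ β :=
    RemainderExplicitHistoryHalfMomentWitness.lower (γ := γ) (lam := fun k i => ρ (k - i)) hβ (fun k i => hρ0 _)
  have h1 := inv_sq_lower_of_betaLower hA hbox hlo hj
  have hgj := hbox j hj
  have hgK := hbox K le_rfl
  have hK0 : 0 ≤ 1 / (g K) ^ 2 := by positivity
  have h2 : b * ((K - j : ℕ) : ℝ) ≤ 1 / (g j) ^ 2 := by linarith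
  have h3 : (g j) ^ 2 * (b * ((K - j : ℕ) : ℝ)) ≤ 1 := by
    have := mul_le_mul_of_nonneg_left h2 (pow_pos hgj.1 2).le
    rwa [mul_one_div_cancel (pow_pos hgj.1 2).ne'] at this
  rw [le_div_iff₀ hb]
  calc (g j) ^ 3 * ((K - j : ℕ) : ℝ) * b = g j * ((g j) ^ 2 * (b * ((K - j : ℕ) : ℝ))) := by ring
    _ ≤ γ * 1 := mul_le_mul hgj.2 h3 (by positivity) (by linarith [hgj.1])
    _ = γ := mul_one γ

/-! ## §4 Exact monotonicity in the position beyond the memory, for every non-increasing profile -/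

/-- THE DECREMENT BEYOND THE MEMORY (any `ρ ≥ 0`): at a position `j₀ < K` with `ρ(a) = 0` for `a > j₀`,
`d_{j₀} − d_{j₀+1} = Σ_{i<j₀} ρ(j₀−i)·e_i − (Σ_{i<j₀} ρ(j₀−i))·e_{j₀}` — B has no extra age of positive weight there, and the age-`0` term of the
common feedback vanishes. [cite: Balaban1987RG1, (0.20) p.256] -/
theorem disc_step_beyond
    (hβ : ∀ (k : ℕ) (p : Fin (k + 1) → ℝ),
      β k p = b + ∑ i : Fin (k + 1), ρ (k - i) * min (p (Fin.last k)) (|p (Fin.last k) - p i|))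
    (hb : 0 < b) (hρ0 : ∀ a, 0 ≤ ρ a) {K n : ℕ} {gA gB : ℕ → ℝ} (hA : RGEqH K β gA) (hB : RGEqH (K + n) β gB)
    (hApos : ∀ k, k ≤ K → 0 < gA k) (hBpos : ∀ k, k ≤ K + n → 0 < gB k) {j₀ : ℕ} (hj₀ : j₀ < K)
    (hsupp : ∀ a, j₀ < a → ρ a = 0) :
    (1 / (gB (j₀ + n)) ^ 2 - 1 / (gA j₀) ^ 2) - (1 / (gB (j₀ + 1 + n)) ^ 2 - 1 / (gA (j₀ + 1)) ^ 2)
      = ∑ i ∈ range j₀, ρ (j₀ - i) * (gA i - gB (i + n)) - (∑ i ∈ range j₀, ρ (j₀ - i)) * (gA j₀ - gB (j₀ + n)) := by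
  rw [disc_step_window hβ hb hρ0 hA hB hApos hBpos hj₀]
  have hE : ∑ i ∈ range n, ρ (j₀ + n - i) * (gB (j₀ + n) - gB i) = 0 := by
    refine Finset.sum_eq_zero fun i hi => ?_
    have hi' := Finset.mem_range.mp hi
    rw [hsupp (j₀ + n - i) (by omega), zero_mul]
  rw [hE, zero_add, Finset.sum_range_succ, Nat.sub_self, sub_self, mul_zero, add_zero, Finset.sum_mul, ← Finset.sum_sub_distrib]
  exact Finset.sum_congr rfl fun i _ => by ring

/-- **THE DECREMENT BEYOND THE MEMORY IS AT LEAST `(1 − Wγ∕(2b))` OF THE WINDOW SUM.**  Road P3's order-0 profile family in ]0,γ] (`b > 0`,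
`ρ ≥ 0` NON-INCREASING on the positive ages, `Σ_{a<N} ρ(a) ≤ W`); two runs — A: `K` steps, B: `K + n` steps — pinned `g^A_K = g^B_{K+n}`; a
position `j₀ < K` beyond the memory (`ρ(a) = 0` for `a > j₀`).  THEN
`(1 − Wγ∕(2b))·Σ_{i<j₀} ρ(j₀−i)·(g^A_i − g^B_{i+n}) ≤ d_{j₀} − d_{j₀+1}`, `d_j = 1∕(g^B_{j+n})² − 1∕(g^A_j)²`.  PROOF: `d_{j₀} − d_{j₀+1} = S − R′·e_{j₀}`
(`disc_step_beyond`; `S` the window sum, `R′ ≤ W`), `e_{j₀} ≤ ((g^A_{j₀})³∕2)·d_{j₀}` (`…Weights.gap_le_cube_mul`), `d_{j₀} ≤ (K − j₀)·S` (`disc_le_mul_windowSum`: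
at most `K − j₀` echoes of each past gap lie ahead, each weighted by at most the gap's weight in `S`), and `(g^A_{j₀})³·(K − j₀) ≤ γ∕b`
(`cube_mul_dist_le`).  No induction, no cone: the pin enters only through the window identity. [cite: Balaban1987RG1, (0.20) p.256, (0.31) and Thm 2 p.259] -/
theorem windowSum_le_disc_step
    (hβ : ∀ (k : ℕ) (p : Fin (k + 1) → ℝ),
      β k p = b + ∑ i : Fin (k + 1), ρ (k - i) * min (p (Fin.last k)) (|p (Fin.last k) - p i|))
    (hb : 0 < b) (hρ0 : ∀ a, 0 ≤ ρ a) (hρW : ∀ n, ∑ a ∈ range n, ρ a ≤ W) (hmono : ∀ a, 1 ≤ a → ρ (a + 1) ≤ ρ a)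
    {K n : ℕ} {gA gB : ℕ → ℝ} (hA : RGEqH K β gA) (hB : RGEqH (K + n) β gB) (hAbox : ∀ k, k ≤ K → 0 < gA k ∧ gA k ≤ γ)
    (hBpos : ∀ k, k ≤ K + n → 0 < gB k) (hpin : gA K = gB (K + n)) {j₀ : ℕ} (hj₀ : j₀ < K) (hsupp : ∀ a, j₀ < a → ρ a = 0) :
    (1 - W * γ / (2 * b)) * ∑ i ∈ range j₀, ρ (j₀ - i) * (gA i - gB (i + n))
      ≤ (1 / (gB (j₀ + n)) ^ 2 - 1 / (gA j₀) ^ 2) - (1 / (gB (j₀ + 1 + n)) ^ 2 - 1 / (gA (j₀ + 1)) ^ 2) := by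
  have hApos : ∀ k, k ≤ K → 0 < gA k := fun k hk => (hAbox k hk).1
  have hdom := invSq_le_invSq_shift_run hβ hb hρ0 hA hB hApos hBpos hpin
  set S : ℝ := ∑ i ∈ range j₀, ρ (j₀ - i) * (gA i - gB (i + n)) with hS_def
  set dj : ℝ := 1 / (gB (j₀ + n)) ^ 2 - 1 / (gA j₀) ^ 2 with hdj_def
  -- the window sum and the discrepancy are nonnegative
  have hS0 : 0 ≤ S := Finset.sum_nonneg fun i hi => by
    have hi' := Finset.mem_range.mp hi
    refine mul_nonneg (hρ0 _) ?_
    linarith [le_of_one_div_sq_le (hApos i (by omega)) (hBpos (i + n) (by omega)) (hdom i (by omega))]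
  -- the self-weight `R′ = Σ_{i<j₀} ρ(j₀−i) ≤ W`
  have hR' : ∑ i ∈ range j₀, ρ (j₀ - i) ≤ W := by
    have hrefl : ∑ i ∈ range j₀, ρ (j₀ - i) = ∑ a ∈ Ico 1 (j₀ + 1), ρ a := by
      rw [Finset.sum_Ico_eq_sum_range, show j₀ + 1 - 1 = j₀ by omega, ← Finset.sum_range_reflect _ j₀]
      refine Finset.sum_congr rfl fun i hi => ?_
      have hi' := Finset.mem_range.mp hi
      congr 1; omega
    rw [hrefl]
    calc ∑ a ∈ Ico 1 (j₀ + 1), ρ a ≤ ∑ a ∈ range (j₀ + 1), ρ a := by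
          rw [← Finset.sum_range_add_sum_Ico _ (show 1 ≤ j₀ + 1 by omega), Finset.sum_range_one]
          linarith [hρ0 0]
      _ ≤ W := hρW _
  have hR'0 : 0 ≤ ∑ i ∈ range j₀, ρ (j₀ - i) := Finset.sum_nonneg fun i _ => hρ0 _
  -- the current gap through the cube, the echo bound, and the ultraviolet suppression
  have hgap : gA j₀ - gB (j₀ + n) ≤ (gA j₀) ^ 3 / 2 * dj :=
    gap_le_cube_mul (hBpos (j₀ + n) (by omega)) (le_of_one_div_sq_le (hApos j₀ hj₀.le) (hBpos (j₀ + n) (by omega)) (hdom j₀ hj₀.le))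
  have hecho : dj ≤ ((K - j₀ : ℕ) : ℝ) * S := disc_le_mul_windowSum hβ hb hρ0 hmono hA hB hApos hBpos hpin hj₀.le hsupp
  have huv : (gA j₀) ^ 3 * ((K - j₀ : ℕ) : ℝ) ≤ γ / b := cube_mul_dist_le hβ hb hρ0 hA hAbox hj₀.le
  have hg3 : 0 ≤ (gA j₀) ^ 3 := pow_nonneg (hApos j₀ hj₀.le).le 3
  -- assemble
  have hself : (∑ i ∈ range j₀, ρ (j₀ - i)) * (gA j₀ - gB (j₀ + n)) ≤ W * γ / (2 * b) * S := by
    calc (∑ i ∈ range j₀, ρ (j₀ - i)) * (gA j₀ - gB (j₀ + n))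
        ≤ W * ((gA j₀) ^ 3 / 2 * (((K - j₀ : ℕ) : ℝ) * S)) := by
          refine mul_le_mul hR' (hgap.trans (mul_le_mul_of_nonneg_left hecho (by positivity))) ?_ ?_
          · linarith [le_of_one_div_sq_le (hApos j₀ hj₀.le) (hBpos (j₀ + n) (by omega)) (hdom j₀ hj₀.le)]
          · exact hR'0.trans hR'
      _ = W * ((gA j₀) ^ 3 * ((K - j₀ : ℕ) : ℝ)) / 2 * S := by ring
      _ ≤ W * (γ / b) / 2 * S := by
          have hW : 0 ≤ W := hR'0.trans hR'
          have := mul_le_mul_of_nonneg_left huv hW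
          nlinarith
      _ = W * γ / (2 * b) * S := by field_simp
  rw [disc_step_beyond hβ hb hρ0 hA hB hApos hBpos hj₀ hsupp]
  linarith

/-- **EXACT MONOTONICITY IN THE POSITION BEYOND THE MEMORY, EVERY NON-INCREASING PROFILE.**  Road P3's order-0 profile family in ]0,γ]
(`b > 0`, `ρ ≥ 0` non-increasing on the positive ages, `Σ_{a<N} ρ(a) ≤ W`, `Wγ ≤ 2b` — the family's `Wγ < b` with room); two runs — A: `K`
steps, B: `K + n` steps — pinned `g^A_K = g^B_{K+n}`.  THEN at every position `j₀ < K` beyond the memory (`ρ(a) = 0` for all `a > j₀`):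
`1∕(g^B_{j₀+1+n})² − 1∕(g^A_{j₀+1})² ≤ 1∕(g^B_{j₀+n})² − 1∕(g^A_{j₀})²` — census item (i′) of generations 50–53 in the source-free stretch, for
every memory length and every shift (`windowSum_le_disc_step`). [cite: Balaban1987RG1, (0.20) p.256, (0.31) and Thm 2 p.259] -/
theorem disc_succ_le_disc_beyond
    (hβ : ∀ (k : ℕ) (p : Fin (k + 1) → ℝ),
      β k p = b + ∑ i : Fin (k + 1), ρ (k - i) * min (p (Fin.last k)) (|p (Fin.last k) - p i|))
    (hb : 0 < b) (hρ0 : ∀ a, 0 ≤ ρ a) (hρW : ∀ n, ∑ a ∈ range n, ρ a ≤ W) (hmono : ∀ a, 1 ≤ a → ρ (a + 1) ≤ ρ a)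
    (hWγ : W * γ ≤ 2 * b) {K n : ℕ} {gA gB : ℕ → ℝ} (hA : RGEqH K β gA) (hB : RGEqH (K + n) β gB)
    (hAbox : ∀ k, k ≤ K → 0 < gA k ∧ gA k ≤ γ) (hBpos : ∀ k, k ≤ K + n → 0 < gB k) (hpin : gA K = gB (K + n)) {j₀ : ℕ}
    (hj₀ : j₀ < K) (hsupp : ∀ a, j₀ < a → ρ a = 0) :
    1 / (gB (j₀ + 1 + n)) ^ 2 - 1 / (gA (j₀ + 1)) ^ 2 ≤ 1 / (gB (j₀ + n)) ^ 2 - 1 / (gA j₀) ^ 2 := by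
  have hApos : ∀ k, k ≤ K → 0 < gA k := fun k hk => (hAbox k hk).1
  have hdom := invSq_le_invSq_shift_run hβ hb hρ0 hA hB hApos hBpos hpin
  have h := windowSum_le_disc_step hβ hb hρ0 hρW hmono hA hB hAbox hBpos hpin hj₀ hsupp
  have hS0 : 0 ≤ ∑ i ∈ range j₀, ρ (j₀ - i) * (gA i - gB (i + n)) := Finset.sum_nonneg fun i hi => by
    have hi' := Finset.mem_range.mp hi
    refine mul_nonneg (hρ0 _) ?_
    linarith [le_of_one_div_sq_le (hApos i (by omega)) (hBpos (i + n) (by omega)) (hdom i (by omega))]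
  have hc : 0 ≤ 1 - W * γ / (2 * b) := by
    rw [sub_nonneg, div_le_one (by positivity)]; exact hWγ
  nlinarith

/-- **BOUNDED MEMORY `A`: MONOTONE AT EVERY POSITION `j ≥ A`.**  Same family with `ρ(a) = 0` for `a > A` (ages `1, …, A`, non-increasing
weights, `Wγ ≤ 2b`); same two pinned runs: for every `j` with `A ≤ j < K`, `d_{j+1} ≤ d_j`. [cite: Balaban1987RG1, (0.20) p.256, (0.31) and Thm 2 p.259] -/
theorem disc_succ_le_disc_of_memory_le
    (hβ : ∀ (k : ℕ) (p : Fin (k + 1) → ℝ),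
      β k p = b + ∑ i : Fin (k + 1), ρ (k - i) * min (p (Fin.last k)) (|p (Fin.last k) - p i|))
    (hb : 0 < b) (hρ0 : ∀ a, 0 ≤ ρ a) (hρW : ∀ n, ∑ a ∈ range n, ρ a ≤ W) (hmono : ∀ a, 1 ≤ a → ρ (a + 1) ≤ ρ a)
    (hWγ : W * γ ≤ 2 * b) {A : ℕ} (hρA : ∀ a, A < a → ρ a = 0) {K n : ℕ} {gA gB : ℕ → ℝ} (hA : RGEqH K β gA)
    (hB : RGEqH (K + n) β gB) (hAbox : ∀ k, k ≤ K → 0 < gA k ∧ gA k ≤ γ) (hBpos : ∀ k, k ≤ K + n → 0 < gB k)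
    (hpin : gA K = gB (K + n)) {j : ℕ} (hAj : A ≤ j) (hj : j < K) :
    1 / (gB (j + 1 + n)) ^ 2 - 1 / (gA (j + 1)) ^ 2 ≤ 1 / (gB (j + n)) ^ 2 - 1 / (gA j) ^ 2 :=
  disc_succ_le_disc_beyond hβ hb hρ0 hρW hmono hWγ hA hB hAbox hBpos hpin hj fun a ha => hρA a (by omega)

/-! ## §5 Pinned family with bounded non-increasing memory: the continuum correction grows towards the ultraviolet end beyond the memory -/

/-- **FAMILY FORM.**  A pinned family of runs (`g K` the run with `K` steps in ]0,γ], `g K K = g_IR`) of the order-0 profile family with a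
non-increasing profile of memory `A` (`ρ(a+1) ≤ ρ(a)` for `a ≥ 1`, `ρ(a) = 0` for `a > A`, `Σ_{a<N} ρ(a) ≤ W`, `Wγ ≤ 2b`): for all `m, n` and
every position `j ≥ A`, `invSq g m (j+1+n) − invSq g m (j+1) ≤ invSq g (m+1) (j+n) − invSq g (m+1) j` (runs of lengths `j+1+m` and
`j+1+m+n`; `disc_succ_le_disc_of_memory_le` BY NAME). [cite: Balaban1987RG1, (0.20) p.256, (0.31) and Thm 2 p.259] -/
theorem invSq_shift_mono_beyond
    (hβ : ∀ (k : ℕ) (p : Fin (k + 1) → ℝ),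
      β k p = b + ∑ i : Fin (k + 1), ρ (k - i) * min (p (Fin.last k)) (|p (Fin.last k) - p i|))
    (hb : 0 < b) (hρ0 : ∀ a, 0 ≤ ρ a) (hρW : ∀ n, ∑ a ∈ range n, ρ a ≤ W) (hmono : ∀ a, 1 ≤ a → ρ (a + 1) ≤ ρ a)
    (hWγ : W * γ ≤ 2 * b) {A : ℕ} (hρA : ∀ a, A < a → ρ a = 0) {g : ℕ → ℕ → ℝ} {gIR : ℝ} (hrun : ∀ K, RGEqH K β (g K))
    (hbox : ∀ K i, i ≤ K → 0 < g K i ∧ g K i ≤ γ) (hpin : ∀ K, g K K = gIR) (m n : ℕ) {j : ℕ} (hAj : A ≤ j) :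
    invSq g m (j + 1 + n) - invSq g m (j + 1) ≤ invSq g (m + 1) (j + n) - invSq g (m + 1) j := by
  have hA : RGEqH (j + 1 + m) β (g (j + 1 + m)) := hrun _
  have hB : RGEqH (j + 1 + m + n) β (g (j + 1 + m + n)) := hrun _
  have hpin' : g (j + 1 + m) (j + 1 + m) = g (j + 1 + m + n) (j + 1 + m + n) := by rw [hpin, hpin]
  have h := disc_succ_le_disc_of_memory_le hβ hb hρ0 hρW hmono hWγ hρA hA hB (fun k hk => hbox _ k hk)
    (fun k hk => (hbox _ k hk).1) hpin' hAj (by omega)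
  have e1 : invSq g m (j + 1 + n) = 1 / (g (j + 1 + m + n) (j + 1 + n)) ^ 2 := by
    rw [invSq_def, show j + 1 + n + m = j + 1 + m + n by omega]
  have e2 : invSq g m (j + 1) = 1 / (g (j + 1 + m) (j + 1)) ^ 2 := by rw [invSq_def]
  have e3 : invSq g (m + 1) (j + n) = 1 / (g (j + 1 + m + n) (j + n)) ^ 2 := by
    rw [invSq_def, show j + n + (m + 1) = j + 1 + m + n by omega]
  have e4 : invSq g (m + 1) j = 1 / (g (j + 1 + m) j) ^ 2 := by
    rw [invSq_def, show j + (m + 1) = j + 1 + m by omega]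
  rw [e1, e2, e3, e4]
  exact h

/-- **THE CONTINUUM CORRECTION GROWS TOWARDS THE ULTRAVIOLET END BEYOND THE MEMORY** (`γ > 0`).  Same family: for every `m` and every
position `j ≥ A`, `astar g m − invSq g m (j+1) ≤ astar g (m+1) − invSq g (m+1) j` — along the ONE run of length `j + 1 + m` the discrepancy
from the continuum coupling at infrared distance `m` is at most the one at `m + 1` (`n → ∞` in `invSq_shift_mono_beyond`, by generation 47's
`continuum_monotone`). [cite: Balaban1987RG1, (0.20) p.256, (0.31) and Thm 2 p.259] -/
theorem astar_sub_invSq_mono_beyond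
    (hβ : ∀ (k : ℕ) (p : Fin (k + 1) → ℝ),
      β k p = b + ∑ i : Fin (k + 1), ρ (k - i) * min (p (Fin.last k)) (|p (Fin.last k) - p i|))
    (hb : 0 < b) (hγ : 0 < γ) (hρ0 : ∀ a, 0 ≤ ρ a) (hρW : ∀ n, ∑ a ∈ range n, ρ a ≤ W) (hmono : ∀ a, 1 ≤ a → ρ (a + 1) ≤ ρ a)
    (hWγ : W * γ ≤ 2 * b) {A : ℕ} (hρA : ∀ a, A < a → ρ a = 0) {g : ℕ → ℕ → ℝ} {gIR : ℝ} (hrun : ∀ K, RGEqH K β (g K))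
    (hbox : ∀ K i, i ≤ K → 0 < g K i ∧ g K i ≤ γ) (hpin : ∀ K, g K K = gIR) (m : ℕ) {j : ℕ} (hAj : A ≤ j) :
    astar g m - invSq g m (j + 1) ≤ astar g (m + 1) - invSq g (m + 1) j := by
  have hlim := (continuum_monotone hβ hb hγ hρ0 hρW hrun hbox hpin).1
  have h1 : Tendsto (fun n => invSq g m (j + 1 + n) - invSq g m (j + 1)) atTop (𝓝 (astar g m - invSq g m (j + 1))) :=
    ((hlim m).comp (tendsto_atTop_atTop_of_monotone (fun a b hab => by omega) fun n => ⟨n, by omega⟩)).sub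
      tendsto_const_nhds
  have h2 : Tendsto (fun n => invSq g (m + 1) (j + n) - invSq g (m + 1) j) atTop
      (𝓝 (astar g (m + 1) - invSq g (m + 1) j)) :=
    ((hlim (m + 1)).comp (tendsto_atTop_atTop_of_monotone (fun a b hab => by omega) fun n => ⟨n, by omega⟩)).sub
      tendsto_const_nhds
  exact le_of_tendsto_of_tendsto' h1 h2 fun n => invSq_shift_mono_beyond hβ hb hρ0 hρW hmono hWγ hρA hrun hbox hpin m n hAj

/-- TELESCOPED IN THE INFRARED DISTANCE: for every `m`, `t` and every position `j ≥ A`,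
`astar g m − invSq g m (j+t) ≤ astar g (m+t) − invSq g (m+t) j` — along the run of length `j + t + m` the continuum correction at infrared
distance `m` is at most the one at any larger infrared distance `m + t`, as long as the position stays beyond the memory. [cite: Balaban1987RG1, (0.20) p.256, (0.31) and Thm 2 p.259] -/
theorem astar_sub_invSq_mono_beyond_le
    (hβ : ∀ (k : ℕ) (p : Fin (k + 1) → ℝ),
      β k p = b + ∑ i : Fin (k + 1), ρ (k - i) * min (p (Fin.last k)) (|p (Fin.last k) - p i|))
    (hb : 0 < b) (hγ : 0 < γ) (hρ0 : ∀ a, 0 ≤ ρ a) (hρW : ∀ n, ∑ a ∈ range n, ρ a ≤ W) (hmono : ∀ a, 1 ≤ a → ρ (a + 1) ≤ ρ a)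
    (hWγ : W * γ ≤ 2 * b) {A : ℕ} (hρA : ∀ a, A < a → ρ a = 0) {g : ℕ → ℕ → ℝ} {gIR : ℝ} (hrun : ∀ K, RGEqH K β (g K))
    (hbox : ∀ K i, i ≤ K → 0 < g K i ∧ g K i ≤ γ) (hpin : ∀ K, g K K = gIR) (m t : ℕ) {j : ℕ} (hAj : A ≤ j) :
    astar g m - invSq g m (j + t) ≤ astar g (m + t) - invSq g (m + t) j := by
  induction t generalizing m with
  | zero => simp
  | succ t ih =>
    have h1 := astar_sub_invSq_mono_beyond hβ hb hγ hρ0 hρW hmono hWγ hρA hrun hbox hpin m (j := j + t) (by omega)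
    have h2 := ih (m + 1)
    rw [show j + (t + 1) = j + t + 1 by omega, show m + (t + 1) = m + 1 + t by omega]
    linarith

end Summit.QuantumFields.BalabanUV.Beta.RemainderExplicitHistoryDiagonalEchoMonotone
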